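import Summits.QuantumFields.BalabanUV.T4Continuum.Support.NE7BlockAverageContourGauge

/-!
# NE7BlockAverageContourGaugeTwoSystem — H-1″ companion: the TWO-SYSTEM contour average (entry corner data `T`, exit
# corner data `S`); its coarse plaquettes are `n·plaq(Q_k A)` plus the coarse plaquette of the LOOP POTENTIAL `Ψ_{T,S}`,
# and reduce to `Q_k`'s exactly when `Ψ_{T,S}(y + e_μ) = Ψ_{T,S}(y + e_ν)` — the precise content of the calc lane's
# «SENSITIVITY» line (ERRATUM E-g52-1 on the mechanism sentence of `NE7BlockAverageContourGauge`, docstring ll.67–69)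

Cell `pub-balaban`, rung (B)+1 sub-cell t4, lineage `b2b-balaban-t4-ne7-p2` (CRUX PROVER NE7 #2 under the coordinator
ruling «YM redirect», 2026-08-21; generation 52; texts `HOME/t4/b2b-balaban-t4-ne7-p2/g52/HOM-JUNCTION-NE7-P2.md` v3.2 §2‴,
the crux refuter's `HOME/b2b-balaban-t4-ne7-refuter/PRICING-NE7.md` v7 §39(c) «CONCUR ON THE CONCLUSION, CORRECT THE
MECHANISM … GENERAL TWO-SYSTEM LEMMA (offered to p2 as an optional ≈ 20-line `QconOp₂` companion of `plaq_QconOp`)» and its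
first-principles check F29).  HONEST FRAMING (page 1): FIXED FINITE T⁴, rung (B)+1 = existence AND uniqueness of the
`ε = L^{−K} → 0` limit of unit-scale averaged expectations, CONDITIONAL on BetaPertH and the nine spine estimates (0/9
proved); NOT infinite volume, NOT a mass gap, NOT the Clay problem.  NE7 is NOT PRINTED in [Balaban1984PropagatorsI]–
[Balaban1989LargeFieldII] and NOT proved here.  Everything below is [folklore] linear bookkeeping on the typed torus for
LINEARISED ABELIAN objects; two definitions (our bookkeeping objects `QconOp₂`, `loopPot`), nothing printed asserted, no
`sorry`.

WHY (ERRATUM E-g52-1, wording only — no statement of `NE7BlockAverageContourGauge` is affected).  That module's docstring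
ll.67–69 attributes the calc lane's SENSITIVITY observation («reading B7 (14)'s last piece `Γ_{x(c),c₊}` literally as the
tree contour ROOTED AT THE FINE POINT makes the Δ1 defect O(|p|³)», `NE7-P-HOM-1.md` §1) to «a transporter system depending on
the bond DIRECTION».  The refuter (PRICING-NE7 v7 §39(c)) located the right mechanism: the fine-rooted last piece
`S(c₊, j) := A(tree contour from x_j + n e_μ down to the corner c₊)` is CORNER DATA exactly like the entry transporter `T`
(a function of the exit corner and the digit `j`, with NO dependence on the bond direction); what distinguishes that reading
from `QconOp T` is the ENTRY∕EXIT ASYMMETRY `S ≠ −T` (the exit path is not the entry path reversed).  This file types the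
general statement: the TWO-SYSTEM average `QconOp₂ T S` (§1), its reduction `QconOp₂ T S A = QconOp T A + Ψ_{T,S}(· + e_μ)`
with the LOOP POTENTIAL `Ψ_{T,S} := Φ_T + Φ_S` (block mean of the linearised holonomies of the closed loops corner → x_j →
corner), the plaquette identity `plaq(QconOp₂ T S A) = n·plaq(Q_k A) + (Ψ_{T,S}(y + e_μ) − Ψ_{T,S}(y + e_ν))` (§2) and the
pointwise criterion «reduces to `Q_k`'s iff `Ψ_{T,S}(y + e_μ) = Ψ_{T,S}(y + e_ν)`»; `S = −T` (every system whose exit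
transporter is the reverse of its entry transporter — B5 (1.7) trees read as B7 (48) requires, B12 (0.11) permutation
averages) gives `Ψ ≡ 0` and recovers `QconOp` and `plaq_QconOp` (§3).  So the corrected sentence is a theorem: «a contour
system whose EXIT transporter is not the reverse of its ENTRY transporter is of the two-system form `QconOp₂ T S`; its
plaquettes are `n·plaq Q_k + (Ψ(y+e_μ) − Ψ(y+e_ν))` and reduce to `Q_k`'s iff `Ψ` is plaquette-closed».

WHAT IS PROVED ([folklore]).  §1 `QconOp₂`, `QconOp₂_apply`, `loopPot`, **`QconOp₂_eq_QconOp_add`** (`Q^{T,S}A(y,μ) =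
Q^T A(y,μ) + Ψ_{T,S}(y+e_μ)`), **`QconOp₂_eq`** (`= n·(Q_kA)(y,μ) − (Φ_T(y+e_μ) − Φ_T(y)) + Ψ_{T,S}(y+e_μ)`).
§2 **`plaq_QconOp₂`**, **`plaq_QconOp₂_eq_iff`** (pointwise criterion), `plaq_QconOp₂_of_closed` (globally: plaquette-closed
`Ψ` ⟹ all plaquettes reduce).  §3 `loopPot_neg` (`Ψ_{T,−T} = 0`), **`QconOp₂_neg_eq_QconOp`** (`S = −T` is the one-system
average), `plaq_QconOp₂_neg`.
NOT HERE: any identification of a particular printed contour recipe with particular data `(T, S)` beyond the docstrings (a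
reading of print, PRICING v7 §39(b)); Wilson deficits of two-system averages (no consumer); anything non-abelian or
non-linear.  NOT NE7 (spine 0/9 unchanged), NOT summit progress.  HONEST DEPENDENCY: continuum YM on T⁴ ⇐ BetaPertH ∧ nine
spine estimates (0/9 proved); BetaPertH ⇐ (D1) ∧ (D4) ∧ CAP+tail; G-an2-4 gates asym, D1 and NE2/3/4.
-/

noncomputable section

open Finset Complex
open scoped BigOperators Matrix

namespace Summit.QuantumFields.BalabanUV.T4Continuum.NE7BlockAverageContourGaugeTwoSystem

open Literature.MathematicalPhysics.QuantumFieldTheory.Balaban1983to89.B5Prop11Plancherel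
open Literature.MathematicalPhysics.QuantumFieldTheory.Balaban1983to89.B5Block118
open Literature.MathematicalPhysics.QuantumFieldTheory.Balaban1983to89.B5AverageCurlStokes
open Summit.QuantumFields.BalabanUV.T4Continuum.NE7BlockAverageContourGauge

variable {d : ℕ} (n : ℕ) [NeZero n] (M : Fin d → ℕ) [hM : ∀ μ, NeZero (M μ)]

/-! ## §1 The two-system contour average and the loop potential -/

/-- The LINEARISED TWO-SYSTEM CONTOUR AVERAGE with ENTRY corner data `T` and EXIT corner data `S`, normalisation `n^{−d}`:
`(Q^{T,S} A)(y, μ) = n^{−d} Σ_j [T y j + A([x_j, x_j + e_μ]) + S (y + e_μ) j]` — the exit piece is read as given data of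
the NEXT corner (e.g. a tree contour rooted at the fine point `x_j + n e_μ` and run down to `c₊` by some direction rule),
not as the reverse of the entry piece.  `QconOp T = QconOp₂ T (−T)` (`QconOp₂_neg_eq_QconOp`). [folklore] -/
def QconOp₂ (T S : Tor M → (Fin d → Fin n) → ℂ) (A : Tor (fine n M) × Fin d → ℂ) : Tor M × Fin d → ℂ :=
  fun b => 1 / (n : ℂ) ^ d * ∑ j : Fin d → Fin n, (T b.1 j + lineSum n M A (bpt n M b.1 j) b.2 + S (b.1 + unitVec M b.2) j)

omit [NeZero n] hM in
/-- Unfolding lemma for `QconOp₂`. [folklore] -/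
theorem QconOp₂_apply (T S : Tor M → (Fin d → Fin n) → ℂ) (A : Tor (fine n M) × Fin d → ℂ) (y : Tor M) (μ : Fin d) :
    QconOp₂ n M T S A (y, μ)
      = 1 / (n : ℂ) ^ d * ∑ j : Fin d → Fin n,
          (T y j + lineSum n M A (bpt n M y j) μ + S (y + unitVec M μ) j) := rfl

/-- The LOOP POTENTIAL `Ψ_{T,S}(y) = Φ_T(y) + Φ_S(y) = n^{−d} Σ_j (T y j + S y j)` — the block mean of the linearised
holonomies of the CLOSED loops corner → `x_j` (entry system) → corner (exit system); a gauge-invariant flux functional,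
`≡ 0` when `S = −T`. [folklore] -/
def loopPot (T S : Tor M → (Fin d → Fin n) → ℂ) : Tor M → ℂ :=
  fun y => cornerPot n M T y + cornerPot n M S y

omit [NeZero n] hM in
/-- Unfolding lemma for `loopPot`. [folklore] -/
theorem loopPot_apply (T S : Tor M → (Fin d → Fin n) → ℂ) (y : Tor M) :
    loopPot n M T S y = cornerPot n M T y + cornerPot n M S y := rfl

omit [NeZero n] hM in
/-- **REDUCTION TO THE ONE-SYSTEM AVERAGE**: `(Q^{T,S} A)(y,μ) = (Q^T A)(y,μ) + Ψ_{T,S}(y + e_μ)` — the two-system average is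
the one-system average of the entry data plus the loop potential read at the EXIT corner. [folklore] -/
theorem QconOp₂_eq_QconOp_add (T S : Tor M → (Fin d → Fin n) → ℂ) (A : Tor (fine n M) × Fin d → ℂ) (y : Tor M)
    (μ : Fin d) :
    QconOp₂ n M T S A (y, μ) = QconOp n M T A (y, μ) + loopPot n M T S (y + unitVec M μ) := by
  rw [QconOp₂_apply, QconOp_apply, loopPot_apply, cornerPot, cornerPot, ← mul_add, ← mul_add, ← Finset.sum_add_distrib,
    ← Finset.sum_add_distrib]
  congr 1
  refine Finset.sum_congr rfl fun j _ => ?_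
  ring

/-- … hence `(Q^{T,S} A)(y,μ) = n·(Q_kA)(y,μ) − (Φ_T(y + e_μ) − Φ_T(y)) + Ψ_{T,S}(y + e_μ)` (`QconOp_eq`). [folklore] -/
theorem QconOp₂_eq (T S : Tor M → (Fin d → Fin n) → ℂ) (A : Tor (fine n M) × Fin d → ℂ) (y : Tor M) (μ : Fin d) :
    QconOp₂ n M T S A (y, μ)
      = (n : ℂ) * (QvOp n M *ᵥ A) (y, μ) - (cornerPot n M T (y + unitVec M μ) - cornerPot n M T y)
          + loopPot n M T S (y + unitVec M μ) := by
  rw [QconOp₂_eq_QconOp_add, QconOp_eq]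

/-! ## §2 Coarse plaquettes of the two-system average -/

/-- **THE TWO-SYSTEM PLAQUETTE IDENTITY**: `plaq(Q^{T,S} A)(y; μ, ν) = n·plaq(Q_kA)(y; μ, ν) + (Ψ_{T,S}(y + e_μ) − Ψ_{T,S}(y + e_ν))`
— the corner-potential parts cancel around `∂p′` (`plaq_QconOp`), the loop potential leaves the coarse plaquette of the
bond field `(y, μ) ↦ Ψ(y + e_μ)`. [folklore] -/
theorem plaq_QconOp₂ (T S : Tor M → (Fin d → Fin n) → ℂ) (A : Tor (fine n M) × Fin d → ℂ) (μ ν : Fin d) (y : Tor M) :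
    plaq M (QconOp₂ n M T S A) μ ν y
      = (n : ℂ) * plaq M (QvOp n M *ᵥ A) μ ν y
          + (loopPot n M T S (y + unitVec M μ) - loopPot n M T S (y + unitVec M ν)) := by
  have h := plaq_QconOp n M T A μ ν y
  simp only [plaq_apply, QconOp₂_eq_QconOp_add] at h ⊢
  rw [add_right_comm y (unitVec M ν) (unitVec M μ)]
  linear_combination h

/-- **THE TWO-SYSTEM CRITERION (pointwise)**: the coarse plaquette of `Q^{T,S} A` at `(y; μ, ν)` is `n·plaq(Q_kA)` iff
`Ψ_{T,S}(y + e_μ) = Ψ_{T,S}(y + e_ν)`. [folklore] -/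
theorem plaq_QconOp₂_eq_iff (T S : Tor M → (Fin d → Fin n) → ℂ) (A : Tor (fine n M) × Fin d → ℂ) (μ ν : Fin d)
    (y : Tor M) :
    plaq M (QconOp₂ n M T S A) μ ν y = (n : ℂ) * plaq M (QvOp n M *ᵥ A) μ ν y
      ↔ loopPot n M T S (y + unitVec M μ) = loopPot n M T S (y + unitVec M ν) := by
  rw [plaq_QconOp₂, add_eq_left, sub_eq_zero]

/-- Globally: if the loop potential is PLAQUETTE-CLOSED (`Ψ(y + e_μ) = Ψ(y + e_ν)` for all `y, μ, ν` — on the torus weaker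
than «`Ψ` constant»), every coarse plaquette of every two-system average with these data reduces to `Q_k`'s. [folklore] -/
theorem plaq_QconOp₂_of_closed (T S : Tor M → (Fin d → Fin n) → ℂ)
    (hΨ : ∀ (y : Tor M) (μ ν : Fin d), loopPot n M T S (y + unitVec M μ) = loopPot n M T S (y + unitVec M ν))
    (A : Tor (fine n M) × Fin d → ℂ) (μ ν : Fin d) (y : Tor M) :
    plaq M (QconOp₂ n M T S A) μ ν y = (n : ℂ) * plaq M (QvOp n M *ᵥ A) μ ν y :=
  (plaq_QconOp₂_eq_iff n M T S A μ ν y).2 (hΨ y μ ν)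

/-! ## §3 `S = −T`: the one-system case -/

omit [NeZero n] hM in
/-- `Ψ_{T,−T} ≡ 0`: when the exit transporter is the reverse of the entry transporter the loops are degenerate. [folklore] -/
theorem loopPot_neg (T : Tor M → (Fin d → Fin n) → ℂ) (y : Tor M) : loopPot n M T (-T) y = 0 := by
  rw [loopPot_apply, cornerPot, cornerPot, ← mul_add, ← Finset.sum_add_distrib]
  simp

omit [NeZero n] hM in
/-- **`S = −T` IS THE ONE-SYSTEM AVERAGE**: `Q^{T,−T} = Q^T` (`QconOp`) — B7 (14) with the last piece `Γ_{c₊,x(c)}` REVERSED,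
as (48) requires and as `B7Prop1Explicit.gammaWord` ∕ `QtreeOp` read it. [folklore] -/
theorem QconOp₂_neg_eq_QconOp (T : Tor M → (Fin d → Fin n) → ℂ) (A : Tor (fine n M) × Fin d → ℂ) :
    QconOp₂ n M T (-T) A = QconOp n M T A := by
  funext ⟨y, μ⟩
  rw [QconOp₂_eq_QconOp_add, loopPot_neg, add_zero]

/-- … so its plaquettes are `n·plaq(Q_kA)` (`plaq_QconOp` recovered from the two-system identity). [folklore] -/
theorem plaq_QconOp₂_neg (T : Tor M → (Fin d → Fin n) → ℂ) (A : Tor (fine n M) × Fin d → ℂ) (μ ν : Fin d) (y : Tor M) :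
    plaq M (QconOp₂ n M T (-T) A) μ ν y = (n : ℂ) * plaq M (QvOp n M *ᵥ A) μ ν y := by
  rw [plaq_QconOp₂, loopPot_neg, loopPot_neg, sub_self, add_zero]

end Summit.QuantumFields.BalabanUV.T4Continuum.NE7BlockAverageContourGaugeTwoSystem

end
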